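import Mathlib
import Literature.Analysis.FluidPDE.LocalTypeI
import Literature.Analysis.FluidPDE.SelfSimilar
import Literature.Analysis.FluidPDE.SelfSimilarLiouville
import Literature.Analysis.FluidPDE.ScalingUniformRecurrence

/-!
# Sketch — crux-ideate stmt-NavierStokesRegularity-1589 (`RecurrentLiouville`), ideator 1, round 1

First-lemma signatures of the two idea cards (they only need to ELABORATE; nothing is proved here).
`CLS u p G C` is the class of the crux verbatim; `REC u` is the recurrence hypothesis verbatim
(= `Literature.Analysis.FluidPDE.IsScalingUniformlyRecurrent u` by `Iff.rfl`).
-/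

-- the sub-problem namespace repeats the summit name (D-0017 layout)
set_option linter.dupNamespace false

namespace Summit.NavierStokesRegularity.NavierStokesRegularity.Cruxes.RecurrentLiouville.Sketch

open MeasureTheory Set Filter Topology
open Literature.Analysis.FluidPDE

noncomputable section

abbrev E3 := EuclideanSpace ℝ (Fin 3)

/-- The class of the crux, verbatim. -/
def CLS (u : ℝ → E3 → E3) (p : ℝ → E3 → ℝ) (G : ℝ → E3 → E3 →L[ℝ] E3) (C : ℝ) : Prop :=
  IsSuitableWeakSolutionOn (slab E3 (Set.Iio 0) isOpen_Iio) 1 0 u p ∧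
  HasWeakSpatialGradientOn (slab E3 (Set.Iio 0) isOpen_Iio) u G ∧
  typeIBound (Set.Iio (0 : ℝ) ×ˢ Set.univ) u p G < ⊤ ∧
  HasTypeITimeDecay C u

/-- The recurrence hypothesis of the crux, verbatim. -/
def REC (u : ℝ → E3 → E3) : Prop :=
  ∀ ε : ℝ, 0 < ε → ∀ K : Set (ℝ × E3), IsCompact K → K ⊆ Set.Iic (0 : ℝ) ×ˢ Set.univ →
    ∃ L : ℝ, 0 < L ∧ ∀ a : ℝ, ∃ σ ∈ Set.Icc a (a + L),
      eLpNorm (fun z : ℝ × E3 => nsRescale (Real.exp σ) u z.1 z.2 - u z.1 z.2) 3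
        (volume.restrict K) ≤ ENNReal.ofReal ε

/-- `REC` is the tree predicate `IsScalingUniformlyRecurrent` (letter for letter). -/
theorem rec_iff (u : ℝ → E3 → E3) : REC u ↔ IsScalingUniformlyRecurrent u := Iff.rfl

/-- Tsai's Type-I DSS Liouville wall, unfolded one level (no `@[conjecture]` constant in the cone),
exactly as route DssFarFieldSlaving writes it. -/
def DSSWall : Prop :=
  ∀ c : ℝ, TypeIDSSLiouville c ∧ ∀ R : E3 ≃ₗᵢ[ℝ] E3, RotatedTypeIDSSLiouville c R

/-! ## Card `pesin-closing-hyperbolic-hulls` -/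

/-- FIRST LEMMA (card 1, endpoint of the closing line; provable now, size S/M):
**accumulation by rotated-DSS Type-I profiles + the DSS wall ⇒ regular**.
If (rotated) `λ`-DSS ancient mild profiles with spatial Type-I decay accumulate at `u` in
`L³(K)` for every compact `K ⊆ {t ≤ 0}`, then the wall makes every approximant a.e. zero, hence
`u = 0` a.e. on the slab and the origin is not backward-singular. -/
def AccumulationKill : Prop :=
  ∀ (u : ℝ → E3 → E3) (p : ℝ → E3 → ℝ) (G : ℝ → E3 → E3 →L[ℝ] E3) (C : ℝ), CLS u p G C →
    (∀ ε : ℝ, 0 < ε → ∀ K : Set (ℝ × E3), IsCompact K → K ⊆ Set.Iic (0 : ℝ) ×ˢ Set.univ →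
      ∃ (c : ℝ) (R : E3 ≃ₗᵢ[ℝ] E3) (w : ℝ → E3 → E3) (C₀ : ℝ), 1 < c ∧
        IsAncientMildSolution 1 w ∧ (∀ t < 0, AEStronglyMeasurable (w t) volume) ∧
        IsRotatedDSS c R w ∧ HasTypeIDecay C₀ w ∧
        eLpNorm (fun z : ℝ × E3 => w z.1 z.2 - u z.1 z.2) 3 (volume.restrict K) ≤ ENNReal.ofReal ε) →
    DSSWall → ¬ IsBackwardSingularPoint u 0

/-- The RELATIVE-PERIODIC rung (card 1, branch (B) and the Kronecker-in-symmetry case): a profile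
whose scaling orbit is periodic modulo one rotation is rotated-DSS; with spatial Type-I decay the
wall kills it.  Stated as the typed reduction (provable now modulo the mildness bridge of the
class, cf. stmt-15368). -/
def RelativePeriodicKill : Prop :=
  ∀ (u : ℝ → E3 → E3) (p : ℝ → E3 → ℝ) (G : ℝ → E3 → E3 →L[ℝ] E3) (C : ℝ), CLS u p G C →
    IsAncientMildSolution 1 u → (∃ C₀ : ℝ, HasTypeIDecay C₀ u) →
    (∃ (c : ℝ) (R : E3 ≃ₗᵢ[ℝ] E3), 1 < c ∧ IsRotatedDSS c R u) →
    DSSWall → ¬ IsBackwardSingularPoint u 0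

/-! ## Card `satellite-exclusion-dark-profiles` -/

/-- FIRST LEMMA (card 2; provable now from the ESS facts `ess_backward_uniqueness`,
`ess_unique_continuation`, size M/L): **dark profiles are trivial**.  A class profile with SPATIAL
Type-I decay whose final-time trace vanishes off the origin (`u(t,x) → 0` as `t ↑ 0` for every
`x ≠ 0`) is regular at the origin (indeed zero). -/
def DarkProfilesAreTrivial : Prop :=
  ∀ (u : ℝ → E3 → E3) (p : ℝ → E3 → ℝ) (G : ℝ → E3 → E3 →L[ℝ] E3) (C : ℝ), CLS u p G C →
    HasTypeIDecay C u →
    (∀ x : E3, x ≠ 0 → Tendsto (fun t : ℝ => u t x) (𝓝[<] (0 : ℝ)) (𝓝 0)) →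
    ¬ IsBackwardSingularPoint u 0

/-- CRUX-GRADE STUB (card 2): **satellite exclusion / decay upgrade**.  A uniformly recurrent
class profile has spatial Type-I decay (equivalently: no final-time singular point off the
origin, equivalently: its radiated tail amplitude is bounded).  Strong form, for `u` itself; the
line only needs it for SOME profile of the hull of `u`. -/
def SatelliteExclusion : Prop :=
  ∀ (u : ℝ → E3 → E3) (p : ℝ → E3 → ℝ) (G : ℝ → E3 → E3 →L[ℝ] E3) (C : ℝ), CLS u p G C →
    REC u → IsBackwardSingularPoint u 0 → ∃ C' : ℝ, HasTypeIDecay C' u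

/-- The TRANSFER of card 2: `RecurrentLiouville` restricted to profiles with spatial Type-I decay. -/
def RecurrentLiouvilleDecayed : Prop :=
  ∀ (u : ℝ → E3 → E3) (p : ℝ → E3 → ℝ) (G : ℝ → E3 → E3 →L[ℝ] E3) (C : ℝ), CLS u p G C →
    HasTypeIDecay C u → REC u → ¬ IsBackwardSingularPoint u 0

/-- Glue of card 2 (pure logic): satellite exclusion + the decayed Liouville ⇒ the crux shape
(note the decay constant is re-fed through `HasTypeIDecay.hasTypeITimeDecay`-style bookkeeping by
the prover; here the decayed statement is quantified over its own constant). -/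
def CruxOfCard2 : Prop :=
  SatelliteExclusion →
  (∀ (u : ℝ → E3 → E3) (p : ℝ → E3 → ℝ) (G : ℝ → E3 → E3 →L[ℝ] E3) (C C' : ℝ), CLS u p G C →
      HasTypeIDecay C' u → REC u → ¬ IsBackwardSingularPoint u 0) →
  ∀ (u : ℝ → E3 → E3) (p : ℝ → E3 → ℝ) (G : ℝ → E3 → E3 →L[ℝ] E3) (C : ℝ), CLS u p G C →
    REC u → ¬ IsBackwardSingularPoint u 0

theorem cruxOfCard2_holds : CruxOfCard2 := by
  intro hS hL u p G C hcls hrec hsing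
  obtain ⟨C', hdec⟩ := hS u p G C hcls hrec hsing
  exact hL u p G C C' hcls hdec hrec hsing

end

end Summit.NavierStokesRegularity.NavierStokesRegularity.Cruxes.RecurrentLiouville.Sketch
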